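import Summits.BirchSwinnertonDyer.Rank1Residual.Additive.QuadraticTwistNewform
import Summits.BirchSwinnertonDyer.Rank1Residual.X4.KuriharaLevelLoweringTwistMinus
import Literature.NumberTheory.EllipticCurves.KuriharaNumber
import HarnessLib

/-!
# The level-lowering certificate and the Kurihara numbers of an additive `W` READ ON ITS QUADRATIC
# TWIST BY AN ARBITRARY ODD FUNDAMENTAL DISCRIMINANT `D` (class X4; cell `b2b-bsdres`, seat additive-p4
# GEN 22, line V41 "minimal-twist reach"; the general-`D` form of `X4TwistLevelLoweringCertificate{,Odd,Eigen}`)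

HONEST FRAMING (cell `b2b-bsdres`, run/shared/lean/b2b/bsd-rank1-residual/, verbatim in every
file): the goal of the cell is to DELETE the COMBINATION-SHAPED residual classes of the
Birch–Swinnerton-Dyer formula for ALL analytic-rank `≤ 1` elliptic curves over `ℚ` — "full BSD
formula for every rank `≤ 1` curve in class `C`" assembled STRICTLY from published theorems — so
that the rank-`≤ 1` remainder becomes exactly the CONSTRUCTION-SHAPED classes, which are TYPED
(missing-input `Prop`s), NOT attempted. This is not "finishing BSD". Seat additive-p4 (X3♯/X4♯
direct): research route on the CONSTRUCTION-SHAPED class X4; no claim beyond the stated classes;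
labels / marks UNCHANGED; NOTHING here is booked. ONE definition (`jacobiHom`: the Jacobi symbol
`u ↦ (u/m)` as a monoid hom `ℤ/m → ℤ/p`, bookkeeping) and theorems; no Literature fact.

## What

`W` (additive at `p`, conductor `N_W`) and its twist `W₀` by an odd fundamental discriminant `D`
(`C • W₀^{(D)} = W`, `W₀` good or multiplicative at the primes dividing `D`; the instruments take
`W₀ :=` the CONDUCTOR-MINIMAL twist, PARI `ellminimaltwist`, level `N₀ ∣ N_W`). By
`Additive/QuadraticTwistNewform.lean`: `[r]⁺_{f_W} = c₀ · ∑_{u mod |D|} (u/|D|)·[r + u/|D|]^{sgn D}_{f_{W₀}}`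
with `|c₀|_p = 1`. Hence:
* §1 `plusSymbolLevelLowersAt_of_jacobiTwistFn` — CURVE-FREE transport for a general modulus `m`:
  if `[r]⁺_{f_W} = c₀ ∑_u (u/m) Φ(r + u/m)` with `p`-integral `c₀`, `Φ`, and `Φ ≡ μ − w·μ∘[ℓ] (mod p)`
  with `μ` periodic and `T_q`-eigen with eigenvalue `(q/m)·a_q(W)` at the Kolyvagin primes of
  `(W, p)` (`m ∣ N_W`, so those primes are prime to `m`), `gcd(ℓ, m) = 1`, `w·(ℓ/m) = 1`, then
  `LevelLowering.PlusSymbolLevelLowersAt W p f_W ℓ` (GEN 21's `…_of_twistSum_fn` with `χ = jacobiHom`);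
  `kuriharaNumber_eq_jacobiTwistSum` — every mod-`p` Kurihara number of `f_W` is `c₀` times a
  twisted Kurihara sum of `Φ` (instrument lemma; `kuriharaNumber_eq_twistSum`).
* §2 `plusSymbolLevelLowersAt_of_quadraticTwist_certificate_of_pos / _of_neg` — the ASSEMBLED
  transport: `W₀`-side certificate data (the mod-`p` `ℓ`-old identity of the plus resp. MINUS symbol
  of `f_{W₀}`, computed by `msfromell(W₀)` at level `N₀` and linear algebra at level `N₀/ℓ`) + the
  period transfers (`p`-adic units; Manin-type binders) ⟹ the certificate of `W`; `c₀` and its unit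
  property come from `QuadraticTwistNewform` (Pal 2012 general `d`, PROVED in the tree) — NO named fact.
With `X4/KuriharaLevelLowering` (`∂^{(∞)} ≥ 1`), `X4/KimDefectLevelLowering{,RankOne}` the BSD_p
closures of the TAM rows follow per pair. Census (kit j135748, this seat): the conductor-minimal
twist has `N₀ ≤ 3·10⁴` on 54 / 176 open rank-0 TAM cells and 150 / 470 rank-1 Tamagawa cells at
`p ≥ 5` (cc-eng-1 R203 companions) — the instrument `twist41.gp` reaches them (EVIDENCE; per pair;
nothing booked).

References: Mazur–Tate–Teitelbaum 1986 §I.8 [MazurTateTeitelbaum1986Invent]; Kim 2026 §1.2.2, §1.4.3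
[Kim2022StructureSelmer]; Pal 2012 Thm. 3.2 [Pal2012]; HOME/b2b-bsdres-additive-p4/README §25.
-/

noncomputable section

open scoped Classical MatrixGroups ModularForm NumberTheorySymbols
open CongruenceSubgroup WeierstrassCurve Literature.NumberTheory.EllipticCurves
  Literature.NumberTheory.EllipticCurves.ModularForms Literature.NumberTheory.QuadraticFields
  IsDedekindDomain NumberField Summit.BirchSwinnertonDyer.Rank1Residual.LevelLowering

namespace Summit.BirchSwinnertonDyer.Rank1Residual.Additive

variable (p : ℕ) [hp : Fact p.Prime]

/-! ## §0 The Jacobi symbol `u ↦ (u / m)` as a monoid hom `ℤ/m → ℤ/p` -/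

/-- **The Jacobi symbol in the top argument as a monoid hom `ℤ/mℤ → ℤ/pℤ`**, `u ↦ (u.val / m)`
(Mathlib's `jacobiSym` is multiplicative and `m`-periodic in the top argument but not bundled; the
tree's `jacobiChar m` is the `ℂ`-valued Dirichlet character). For an odd fundamental discriminant
`D` and `m = |D|` this is the Kronecker symbol `(D/·)` reduced mod `p`. Bookkeeping definition.
[cite: Cox2013, §1.C Lemma 1.14] -/
def jacobiHom (m : ℕ) [NeZero m] : ZMod m →* ZMod p where
  toFun u := ((J((u.val : ℤ) | m) : ℤ) : ZMod p)
  map_one' := by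
    rw [ZMod.val_one_eq_one_mod, jacobiSym_natCast_mod, Nat.cast_one, jacobiSym.one_left, Int.cast_one]
  map_mul' u v := by
    rw [ZMod.val_mul, jacobiSym_natCast_mod, Nat.cast_mul, jacobiSym.mul_left, Int.cast_mul]

/-- `jacobiHom` evaluated. [folklore] -/
@[simp] theorem jacobiHom_apply (m : ℕ) [NeZero m] (u : ZMod m) :
    jacobiHom p m u = ((J((u.val : ℤ) | m) : ℤ) : ZMod p) := rfl

/-- `jacobiHom` on a natural number: `(n / m)`. [folklore] -/
theorem jacobiHom_natCast (m : ℕ) [NeZero m] (n : ℕ) :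
    jacobiHom p m (n : ZMod m) = ((J((n : ℤ) | m) : ℤ) : ZMod p) := by
  rw [jacobiHom_apply, ZMod.val_natCast, jacobiSym_natCast_mod]

/-- `(n/m)² = 1` in `ℤ/p` for `gcd(n, m) = 1`. [folklore] -/
theorem jacobiHom_natCast_sq_eq_one {m : ℕ} [NeZero m] {n : ℕ} (hn : n.Coprime m) :
    jacobiHom p m (n : ZMod m) ^ 2 = 1 := by
  rw [jacobiHom_natCast]
  rcases jacobiSym.eq_one_or_neg_one (a := (n : ℤ)) (b := m)
      (by rw [Int.gcd_natCast_natCast]; exact hn) with h | h <;>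
    rw [h] <;> push_cast <;> norm_num

/-! ## §1 Curve-free transport for a general twisting modulus `m` -/

section CurveFree

variable (W : WeierstrassCurve ℚ) [W.IsGloballyMinimal] {m : ℕ} [NeZero m]
  {NW : ℕ} (fW : CuspForm (Gamma0 NW) 2)

/-- Casting a `p`-integral product of rationals to `ℤ/p`. [folklore] -/
private theorem ratCast_mul_of_not_dvd₃ {a b : ℚ} (ha : ¬ p ∣ a.den) (hb : ¬ p ∣ b.den) :
    ((a * b : ℚ) : ZMod p) = (a : ZMod p) * (b : ZMod p) :=
  Rat.cast_mul_of_ne_zero (mt (ZMod.natCast_eq_zero_iff _ _).mp ha)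
    (mt (ZMod.natCast_eq_zero_iff _ _).mp hb)

/-- A sum of `p`-integral rationals is `p`-integral and casts termwise to `ℤ/p`. [folklore] -/
private theorem ratCast_sum_of_not_dvd₃ {ι : Type*} (s : Finset ι) (g : ι → ℚ)
    (h : ∀ i ∈ s, ¬ p ∣ (g i).den) :
    ¬ p ∣ (∑ i ∈ s, g i).den ∧ ((∑ i ∈ s, g i : ℚ) : ZMod p) = ∑ i ∈ s, ((g i : ℚ) : ZMod p) := by
  classical
  induction s using Finset.induction_on with
  | empty => simp [hp.out.one_lt.ne']
  | insert a s has ih =>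
    have ha : ¬ p ∣ (g a).den := h a (Finset.mem_insert_self a s)
    obtain ⟨hs, hcast⟩ := ih fun i hi ↦ h i (Finset.mem_insert_of_mem hi)
    rw [Finset.sum_insert has, Finset.sum_insert has]
    refine ⟨fun hd ↦ ?_, ?_⟩
    · have := hd.trans (Rat.add_den_dvd (g a) (∑ i ∈ s, g i))
      rcases (Nat.Prime.dvd_mul hp.out).mp this with h1 | h1
      · exact ha h1
      · exact hs h1
    · rw [Rat.cast_add_of_ne_zero (mt (ZMod.natCast_eq_zero_iff _ _).mp ha)
        (mt (ZMod.natCast_eq_zero_iff _ _).mp hs), hcast]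

/-- The ℚ-level twisted-sum identity with `p`-integral data, read in `ℤ/p`. [folklore] -/
theorem ratCast_ratPlusSymbol_eq_jacobiTwistSum (Φ : ℚ → ℚ) (c₀ : ℚ) (hc : ¬ p ∣ c₀.den)
    (hint : ∀ x : ℚ, ¬ p ∣ (Φ x).den)
    (hsym : ∀ r : ℚ, ratPlusSymbol fW r =
      c₀ * ∑ u : ZMod m, (J((u.val : ℤ) | m) : ℚ) * Φ (r + (u.val : ℚ) / m)) (r : ℚ) :
    ((ratPlusSymbol fW r : ℚ) : ZMod p) =
      (c₀ : ZMod p) * ∑ u : ZMod m, jacobiHom p m u * ((Φ (r + (u.val : ℚ) / m) : ℚ) : ZMod p) := by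
  have hterm : ∀ u ∈ (Finset.univ : Finset (ZMod m)),
      ¬ p ∣ ((J((u.val : ℤ) | m) : ℚ) * Φ (r + (u.val : ℚ) / m)).den := by
    intro u _ hd
    have := hd.trans (Rat.mul_den_dvd _ _)
    rw [Rat.den_intCast, one_mul] at this
    exact hint _ this
  obtain ⟨hden, hcast⟩ := ratCast_sum_of_not_dvd₃ p Finset.univ _ hterm
  rw [hsym r, ratCast_mul_of_not_dvd₃ p hc hden, hcast]
  congr 1
  refine Finset.sum_congr rfl fun u _ ↦ ?_
  rw [ratCast_mul_of_not_dvd₃ p (by rw [Rat.den_intCast]; exact hp.out.one_lt.ne' ∘ Nat.dvd_one.mp)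
    (hint _), Rat.cast_intCast, jacobiHom_apply]

/-- **CURVE-FREE TRANSPORT, general modulus.** `W` globally minimal with `m ∣ N_W`; `f_W` a cusp
form whose plus symbol is `c₀ · ∑_{u mod m} (u/m) Φ(r + u/m)` for a `p`-integral `Φ : ℚ → ℚ` and a
`p`-integral `c₀`; `Φ ≡ μ − w·μ∘[ℓ] (mod p)` with `μ` periodic and `T_q`-eigen with eigenvalue
`(q/m)·a_q(W)` at every Kolyvagin prime `q` of `(W, p)`; `gcd(ℓ, m) = 1`, `w·(ℓ/m) = 1`. Then
`PlusSymbolLevelLowersAt W p f_W ℓ`. (`Φ` = the plus or minus symbol of `f_{W₀}`, any `ℓ`-old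
identity found by the instrument at level `N₀/ℓ`; no hypothesis mentions `W₀`.)
[cite: Kim2022StructureSelmer, §1.2.2 and §1.4.3] [cite: MazurTateTeitelbaum1986Invent, §I.4 (4.2) and §I.8] -/
theorem plusSymbolLevelLowersAt_of_jacobiTwistFn (hmN : m ∣ W.conductorNorm ℤ) (Φ : ℚ → ℚ)
    (c₀ : ℚ) (hc : ¬ p ∣ c₀.den) (hint : ∀ x : ℚ, ¬ p ∣ (Φ x).den)
    (hsym : ∀ r : ℚ, ratPlusSymbol fW r =
      c₀ * ∑ u : ZMod m, (J((u.val : ℤ) | m) : ℚ) * Φ (r + (u.val : ℚ) / m))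
    {μ : ℚ → ZMod p} (hμ : IsPeriodic μ) {w : ZMod p} {ℓ : ℕ} (hℓ : ℓ.Coprime m)
    (hV : ∀ r : ℚ, ((Φ r : ℚ) : ZMod p) = μ r - w * μ (ℓ * r))
    (hw : w * ((J((ℓ : ℤ) | m) : ℤ) : ZMod p) = 1)
    (hH : ∀ q : ℕ, Kato.IsKolyvaginPrime W p 1 q →
      HeckeRel μ q (((J((q : ℤ) | m) : ℤ) : ZMod p) * (W.frobeniusTrace q : ZMod p))) :
    PlusSymbolLevelLowersAt W p fW ℓ := by
  set χ : ZMod m →* ZMod p := jacobiHom p m with hχdef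
  set φ : ℚ → ZMod p := fun x ↦ ((Φ x : ℚ) : ZMod p) with hφdef
  have hsymP : ∀ r : ℚ, ((ratPlusSymbol fW r : ℚ) : ZMod p) =
      (c₀ : ZMod p) * ∑ u : ZMod m, χ u * φ (r + (u.val : ℚ) / m) :=
    ratCast_ratPlusSymbol_eq_jacobiTwistSum p fW Φ c₀ hc hint hsym
  have hℓu : IsUnit ((ℓ : ℕ) : ZMod m) := (ZMod.isUnit_iff_coprime ℓ m).mpr hℓ
  have hχℓ : χ ℓ ^ 2 = 1 := jacobiHom_natCast_sq_eq_one p hℓ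
  have hw' : w * χ ℓ = 1 := by rwa [hχdef, jacobiHom_natCast]
  refine plusSymbolLevelLowersAt_of_twistSum_fn W p χ fW (c₀ : ZMod p) φ hsymP hμ hV hℓu hχℓ hw'
    (fun q ↦ χ q * (W.frobeniusTrace q : ZMod p)) fun q hq ↦ ?_
  have hqm : q.Coprime m := by
    refine (Nat.Prime.coprime_iff_not_dvd hq.prime).mpr fun hd ↦ hq.2.1 ?_
    exact (hd.trans hmN).mul_right p
  have hqu : IsUnit ((q : ℕ) : ZMod m) := (ZMod.isUnit_iff_coprime q m).mpr hqm
  have hχq : χ q ^ 2 = 1 := jacobiHom_natCast_sq_eq_one p hqm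
  refine ⟨?_, hqu, hχq, ?_⟩
  · rw [hχdef, jacobiHom_natCast]; exact hH q hq
  · rw [← mul_assoc, ← sq, hχq, one_mul]

/-- **Instrument lemma: the mod-`p` Kurihara numbers of `f_W` are `c₀` times TWISTED Kurihara sums of
`Φ`** — computable on `W₀`'s symbol at level `N₀` (`twist41.gp`; GEN 21's `kuriharaNumber_eq_twistSum`
with `χ = jacobiHom`). [cite: Kim2022StructureSelmer, §1.4.3] [cite: MazurTateTeitelbaum1986Invent, §I.8] -/
theorem kuriharaNumber_eq_jacobiTwistSum (Φ : ℚ → ℚ) (c₀ : ℚ) (hc : ¬ p ∣ c₀.den)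
    (hint : ∀ x : ℚ, ¬ p ∣ (Φ x).den)
    (hsym : ∀ r : ℚ, ratPlusSymbol fW r =
      c₀ * ∑ u : ZMod m, (J((u.val : ℤ) | m) : ℚ) * Φ (r + (u.val : ℚ) / m))
    (n : ℕ) [NeZero n] (ψ : (q : ℕ) → (ZMod q)ˣ →* Multiplicative (ZMod p)) :
    kuriharaNumber fW p n ψ =
      (c₀ : ZMod p) * ∑ a : (ZMod n)ˣ,
        (∑ u : ZMod m, jacobiHom p m u * ((Φ (((a : ZMod n).val : ℚ) / n + (u.val : ℚ) / m) : ℚ) : ZMod p)) *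
        ∏ q ∈ n.primeFactors.attach,
          Multiplicative.toAdd (ψ q.1 (ZMod.unitsMap (Nat.dvd_of_mem_primeFactors q.2) a)) :=
  kuriharaNumber_eq_twistSum (jacobiHom p m) fW (c₀ : ZMod p) (fun x ↦ ((Φ x : ℚ) : ZMod p))
    (ratCast_ratPlusSymbol_eq_jacobiTwistSum p fW Φ c₀ hc hint hsym) n ψ

end CurveFree

/-! ## §2 The assembled transport: the certificate of `W` from the `W₀`-side certificate data -/

section Assembled

variable (W₀ W : WeierstrassCurve ℚ) [W₀.IsElliptic] [W₀.IsGloballyMinimal] [W.IsElliptic]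
  [W.IsGloballyMinimal]

omit hp [W₀.IsElliptic] [W.IsElliptic] [W.IsGloballyMinimal] in
/-- The twist by `D` is additive at the odd primes `ℓ ∥ D` where `W₀` is good or multiplicative
(`D ≡ 1 (mod 4)` square-free). Bookkeeping for the hypotheses of `QuadraticTwistNewform`.
[cite: SilvermanAEC2009, VII.5 Prop. 5.1] -/
theorem hasAdditiveReductionAt_quadraticTwist_of_good_or_mult [W₀.IsElliptic] {D : ℤ}
    (hD4 : D % 4 = 1) (hsq : Squarefree D)
    (hgm : ∀ v : HeightOneSpectrum (𝓞 ℚ), ((Rat.HeightOneSpectrum.primesEquiv v : ℕ) : ℤ) ∣ D →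
      W₀.HasGoodReductionAt v ∨ W₀.HasMultiplicativeReductionAt v) :
    ∀ v : HeightOneSpectrum (𝓞 ℚ), ((Rat.HeightOneSpectrum.primesEquiv v : ℕ) : ℤ) ∣ D →
      (W₀.quadraticTwist (D : ℚ)).HasAdditiveReductionAt v := by
  open Rat.HeightOneSpectrum in
  intro v hvD
  have hD0 : D ≠ 0 := by rintro rfl; norm_num at hD4
  have hv2 : (primesEquiv v : ℕ) ≠ 2 := by
    intro h
    rw [h] at hvD
    have : D % 2 = 0 := Int.emod_eq_zero_of_dvd (by exact_mod_cast hvD)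
    omega
  have hsq' : ¬ ((primesEquiv v : ℕ) : ℤ) ^ 2 ∣ D := by
    intro h
    have hu := hsq ((primesEquiv v : ℕ) : ℤ) (by rw [← sq]; exact h)
    rw [Int.isUnit_iff_natAbs_eq, Int.natAbs_natCast] at hu
    exact (primesEquiv v).2.one_lt.ne' hu
  rcases hgm v hvD with hg | hm
  · exact W₀.hasAdditiveReductionAt_quadraticTwist_of_dvd v hv2 hD0 hvD hsq' hg
  · exact (AdditivePotMult.hasAdditiveReductionAt_quadraticTwist_of_dvd_of_mult W₀ v hv2 hvD hsq' hm).2.1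

/-- **THE CERTIFICATE OF `W ≅ W₀ ⊗ χ_D` COMPUTED ON `W₀`, `D > 0`** (even `χ_D`: plus symbol of
`f_{W₀}`). Inputs: `C • W₀^{(D)} = W` (both globally minimal), `D ≡ 1 (mod 4)` square-free, `W₀`
good or multiplicative at the primes dividing `D`, `|D| ∣ N_W`; the newforms `f_{W₀}`, `f_W` at levels
`N₀ ∣ N_W`, `|D|² ∣ N_W`; the period transfers `Ω(W) = u_W Ω⁺_{f_W}`, `Ω(W₀) = u₀ Ω⁺_{f_{W₀}}` with
`p`-adic units; `p`-integral plus symbols of `f_{W₀}`; and the `W₀`-SIDE CERTIFICATE DATA — `μ`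
periodic, `T_q`-eigen with `(q/|D|)·a_q(W)` at the Kolyvagin primes of `(W, p)`,
`[r]⁺_{f_{W₀}} ≡ μ(r) − w·μ(ℓr)` (computed per pair at level `N₀/ℓ`), `gcd(ℓ, D) = 1`, `w·(ℓ/|D|) = 1`.
Output: `PlusSymbolLevelLowersAt W p f_W ℓ`. The constant `c₀` and `|c₀|_p = 1` are supplied by
`QuadraticTwistNewform` (Pal 2012 general `d`, PROVED in the tree); NO named fact. Any prime `p`.
[cite: Pal2012, Thm. 3.2 with Prop. 2.5] [cite: Kim2022StructureSelmer, §1.2.2 and §1.4.3]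
[cite: MazurTateTeitelbaum1986Invent, §I.8] -/
theorem plusSymbolLevelLowersAt_of_quadraticTwist_certificate_of_pos {D : ℤ} (hD4 : D % 4 = 1)
    (hsq : Squarefree D) (hD : 0 < D) (C : VariableChange ℚ) (hC : C • W₀.quadraticTwist (D : ℚ) = W)
    (hgm : ∀ v : HeightOneSpectrum (𝓞 ℚ), ((Rat.HeightOneSpectrum.primesEquiv v : ℕ) : ℤ) ∣ D →
      W₀.HasGoodReductionAt v ∨ W₀.HasMultiplicativeReductionAt v)
    {N₀ NW : ℕ} [NeZero N₀] [NeZero NW] [NeZero D.natAbs] {f₀ : CuspForm (Gamma0 N₀) 2}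
    {fW : CuspForm (Gamma0 NW) 2} (hf₀ : IsNewformOf W₀ f₀) (hfW : IsNewformOf W fW)
    (hN : N₀ ∣ NW) (hm : D.natAbs ^ 2 ∣ NW) (hmN : D.natAbs ∣ W.conductorNorm ℤ)
    (hperW : ∃ u : ℚ, ‖(u : ℚ_[p])‖ = 1 ∧ W.realPeriodRat = u * plusPeriod fW)
    (hper₀ : ∃ u : ℚ, ‖(u : ℚ_[p])‖ = 1 ∧ W₀.realPeriodRat = u * plusPeriod f₀)
    (hint : ∀ x : ℚ, ¬ p ∣ (ratPlusSymbol f₀ x).den)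
    {μ : ℚ → ZMod p} (hμ : IsPeriodic μ) {w : ZMod p} {ℓ : ℕ} (hℓ : ℓ.Coprime D.natAbs)
    (hV : ∀ r : ℚ, ((ratPlusSymbol f₀ r : ℚ) : ZMod p) = μ r - w * μ (ℓ * r))
    (hw : w * ((J((ℓ : ℤ) | D.natAbs) : ℤ) : ZMod p) = 1)
    (hH : ∀ q : ℕ, Kato.IsKolyvaginPrime W p 1 q →
      HeckeRel μ q (((J((q : ℤ) | D.natAbs) : ℤ) : ZMod p) * (W.frobeniusTrace q : ZMod p))) :
    PlusSymbolLevelLowersAt W p fW ℓ := by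
  have hadd := hasAdditiveReductionAt_quadraticTwist_of_good_or_mult W₀ hD4 hsq hgm
  obtain ⟨c₀, hc₀, hrel⟩ :=
    exists_rat_ratPlusSymbol_eq_twistSum_of_pos W₀ W hD4 hsq hD ⟨C, hC⟩ hadd hf₀ hfW hN hm
  by_cases hex : ∃ r : ℚ, ∑ u : ZMod D.natAbs, (J((u.val : ℤ) | D.natAbs) : ℚ) *
      ratPlusSymbol f₀ (r + (u.val : ℚ) / D.natAbs) ≠ 0
  · obtain ⟨uW, huW, hΩW⟩ := hperW
    obtain ⟨u₀, hu₀, hΩ₀⟩ := hper₀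
    have hunit : ‖(c₀ : ℚ_[p])‖ = 1 :=
      norm_ratCast_eq_one_of_twist_of_pos p W₀ W hD4 hsq hD C hC hgm huW hu₀ hΩW hΩ₀ (hrel hex)
    have hc : ¬ p ∣ c₀.den := not_dvd_den_of_norm_ratCast_le_one hunit.le
    exact plusSymbolLevelLowersAt_of_jacobiTwistFn p W fW hmN (fun x ↦ ratPlusSymbol f₀ x) c₀ hc
      hint hc₀ hμ hℓ hV hw hH
  · simp only [not_exists, not_not] at hex
    refine ⟨0, fun _ _ ↦ rfl, fun q _ r ↦ by simp, fun r ↦ ?_⟩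
    rw [hc₀ r, hex r, mul_zero, Rat.cast_zero, Pi.zero_apply, Pi.zero_apply, sub_zero]

/-- **THE CERTIFICATE OF `W ≅ W₀ ⊗ χ_D` COMPUTED ON `W₀`, `D < 0`** (odd `χ_D`: the MINUS symbol of
`f_{W₀}`; `p` odd): as above with `|Ω⁻(W₀)| = u₀ Ω⁻_{f_{W₀}}`, `p`-integral minus symbols and the
`ℓ`-old identity `[r]⁻_{f_{W₀}} ≡ μ(r) − w·μ(ℓr)`. NO named fact (Pal for `d < 0` is a tree theorem).
[cite: Pal2012, Thm. 3.2 with Prop. 2.5 and p. 1514 (Ω⁻)] [cite: Kim2022StructureSelmer, §1.2.2 and §1.4.3]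
[cite: MazurTateTeitelbaum1986Invent, §I.8] -/
theorem plusSymbolLevelLowersAt_of_quadraticTwist_certificate_of_neg (hp2 : p ≠ 2) {D : ℤ}
    (hD4 : D % 4 = 1) (hsq : Squarefree D) (hD : D < 0) (C : VariableChange ℚ)
    (hC : C • W₀.quadraticTwist (D : ℚ) = W)
    (hgm : ∀ v : HeightOneSpectrum (𝓞 ℚ), ((Rat.HeightOneSpectrum.primesEquiv v : ℕ) : ℤ) ∣ D →
      W₀.HasGoodReductionAt v ∨ W₀.HasMultiplicativeReductionAt v)
    {N₀ NW : ℕ} [NeZero N₀] [NeZero NW] [NeZero D.natAbs] {f₀ : CuspForm (Gamma0 N₀) 2}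
    {fW : CuspForm (Gamma0 NW) 2} (hf₀ : IsNewformOf W₀ f₀) (hfW : IsNewformOf W fW)
    (hN : N₀ ∣ NW) (hm : D.natAbs ^ 2 ∣ NW) (hmN : D.natAbs ∣ W.conductorNorm ℤ)
    (hperW : ∃ u : ℚ, ‖(u : ℚ_[p])‖ = 1 ∧ W.realPeriodRat = u * plusPeriod fW)
    (hper₀ : ∃ u : ℚ, ‖(u : ℚ_[p])‖ = 1 ∧ W₀.imaginaryPeriodRat = u * minusPeriod f₀)
    (hint : ∀ x : ℚ, ¬ p ∣ (ratMinusSymbol f₀ x).den)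
    {μ : ℚ → ZMod p} (hμ : IsPeriodic μ) {w : ZMod p} {ℓ : ℕ} (hℓ : ℓ.Coprime D.natAbs)
    (hV : ∀ r : ℚ, ((ratMinusSymbol f₀ r : ℚ) : ZMod p) = μ r - w * μ (ℓ * r))
    (hw : w * ((J((ℓ : ℤ) | D.natAbs) : ℤ) : ZMod p) = 1)
    (hH : ∀ q : ℕ, Kato.IsKolyvaginPrime W p 1 q →
      HeckeRel μ q (((J((q : ℤ) | D.natAbs) : ℤ) : ZMod p) * (W.frobeniusTrace q : ZMod p))) :
    PlusSymbolLevelLowersAt W p fW ℓ := by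
  have hadd := hasAdditiveReductionAt_quadraticTwist_of_good_or_mult W₀ hD4 hsq hgm
  obtain ⟨c₀, hc₀, hrel⟩ :=
    exists_rat_ratPlusSymbol_eq_twistSum_of_neg W₀ W hD4 hsq hD ⟨C, hC⟩ hadd hf₀ hfW hN hm
  by_cases hex : ∃ r : ℚ, ∑ u : ZMod D.natAbs, (J((u.val : ℤ) | D.natAbs) : ℚ) *
      ratMinusSymbol f₀ (r + (u.val : ℚ) / D.natAbs) ≠ 0
  · obtain ⟨uW, huW, hΩW⟩ := hperW
    obtain ⟨u₀, hu₀, hΩ₀⟩ := hper₀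
    have hunit : ‖(c₀ : ℚ_[p])‖ = 1 :=
      norm_ratCast_eq_one_of_twist_of_neg p W₀ W hp2 hD4 hsq hD C hC hgm huW hu₀ hΩW hΩ₀ (hrel hex)
    have hc : ¬ p ∣ c₀.den := not_dvd_den_of_norm_ratCast_le_one hunit.le
    exact plusSymbolLevelLowersAt_of_jacobiTwistFn p W fW hmN (fun x ↦ ratMinusSymbol f₀ x) c₀ hc
      hint hc₀ hμ hℓ hV hw hH
  · simp only [not_exists, not_not] at hex
    refine ⟨0, fun _ _ ↦ rfl, fun q _ r ↦ by simp, fun r ↦ ?_⟩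
    rw [hc₀ r, hex r, mul_zero, Rat.cast_zero, Pi.zero_apply, Pi.zero_apply, sub_zero]

end Assembled

end Summit.BirchSwinnertonDyer.Rank1Residual.Additive

end
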